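import Summits.QuantumFields.BalabanUV.Beta.GAN24.ContactOneGaugeCellAlgebra

/-!
# `BalabanUV.Beta.GAN24.ContactCellSplit` — binder row G-an2-4 / (CONV-C), the row owner's CONTACT-TERM ROUTE (`gen18/CT3-MECHANISM.md` v1.1 §(c)), CT-3c analysis,
# SPLITTING A DRESSED PARTNER INSIDE leaf-02's ONE-GAUGE CELL: after `ContactOneGaugeCellTable.cell_eq'` the cell is
# `½⟨ψ_tip·T₁, d*dT₃⟩ − ½⟨ψ_mid·T₃, d*dT₁⟩`; an undifferentiated DRESSED partner `T = B + dλ′` contributes its undressed part `B` (a three-envelope term) plus,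
# in the MIDPOINT position, exactly the owner's pairing `Σ_κ Σ'_u t κ u·ψ̄_κ(u)·Δ_κλ′(u)` (`StaircasePairing.abs_pairing_le_sum`), and in the TIP position the tip-read
# pairing `Σ_κ Σ'_u t κ u·ψ(u+e_κ)·Δ_κλ′(u)` (leaf-03 g52's `StaircasePairingReadings.abs_pairingTip_le_of_geometric`; or, expanding `ψ_tip = ψ_mid + ½Δψ`, the
# owner's pairing plus a ΔΔ cross term — variant (a), kept as a socket).

NOT IN PRINT; OUR BOOKKEEPING (G-an2-4 formalisation swarm, leaf prover `b2b-balaban-gan24-formalise-leaf-01`, gen 58; CT-3c under «MINE» l.31499 ∕ 31626 ∕ 31667 ∕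
31740; `CT3C-ANALYSIS-PLAN.md` §2–§3; names PROVISIONAL).  HONEST FRAMING (cell contract, verbatim): «discharging `BetaPertH` makes Bałaban's UV stability
UNCONDITIONAL — a real constructive-QFT result; it is NOT the continuum limit and NOT the Clay problem.»  HONEST DEPENDENCY (verbatim): «continuum YM on T⁴ ⇐
BetaPertH ∧ nine spine estimates (0/9 proved); BetaPertH ⇐ (D1) ∧ (D4) ∧ CAP+tail; G-an2-4 gates asym, D1 and NE2/3/4.»

WHAT (generic `d`; pure algebra under summability — the Maxwell factor `M κ` summable for each `κ`, everything else bounded; `unitVec` = lit-balaban's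
`B6BondElimination.unitVec`, the spelling of leaf-02's cells):
* `split_tip` — `Σ'_u Σ_κ ψ(u+e_κ)·(B κ u + (λ′(u+e_κ) − λ′ u))·M κ u = Σ'_u Σ_κ ψ(u+e_κ)·B κ u·M κ u + Σ_κ Σ'_u M κ u·ψ(u+e_κ)·(λ′(u+e_κ) − λ′ u)`
  (undressed part + the TIP-READ pairing of leaf-03 g52's `StaircasePairingReadings` — the owner's choice (b), l.31846); `split_tip_mid` — the same with
  `ψ_tip = ψ_mid + ½Δψ` expanded (owner's midpoint pairing + the ΔΔ cross term; variant (a), socket only);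
* `split_mid` — `Σ'_z Σ_b ½(ψ z + ψ(z+e_b))·(B b z + (λ′(z+e_b) − λ′ z))·M b z = Σ'_z Σ_b ½(ψ z + ψ(z+e_b))·B b z·M b z + Σ_b Σ'_z M b z·½(ψ z + ψ(z+e_b))·(λ′(z+e_b) − λ′ z)`;
* `split_site` — the index cell's site weight: `Σ'_x Σ_a ψ x·(B a x + (λ′(x+e_a) − λ′ x))·M a x = Σ' Σ ψ·B·M + Σ_a Σ'_x M a x·ψ x·(λ′(x+e_a) − λ′ x)` (not needed on
  the route — the TABLE cell's partners are undressed — recorded for completeness of the socket).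
[folklore] throughout: `ring` under `tsum_add` ∕ `Summable.tsum_finsetSum`; 0 `def`, 0 cited facts, 0 `def … : Prop`, 0 sorry.  NO estimate; discharges NOTHING
of (hS, hSall) on (E); 0 wall binders; NEVER «G-an2-4 closed»; NOT D1, NOT BetaPertH, NOT continuum, NOT Clay.
-/

noncomputable section

open Finset
open scoped BigOperators
open Literature.MathematicalPhysics.QuantumFieldTheory.Balaban1983to89
open Literature.MathematicalPhysics.QuantumFieldTheory.Balaban1983to89.Beta
open AffineAveraging (Form0 Form1)
open B6BondElimination (unitVec)
open KKTFluctuationEnergy (summable_mul_of_bdd summable_mul_of_bdd')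

namespace Summit.QuantumFields.BalabanUV.Beta.GAN24.ContactCellSplit

variable {d : ℕ} {ψ lam : Form0 (d + 1) ℝ} {B M : Form1 (d + 1) ℝ} {Bψ BB Bg : ℝ}

/-- [folklore] (bookkeeping) a bounded function times a bounded function times a summable one is summable. -/
theorem summable_bdd_bdd_mul {f g h : (Fin (d + 1) → ℤ) → ℝ} {Cf Cg : ℝ} (hf : ∀ u, |f u| ≤ Cf) (hg : ∀ u, |g u| ≤ Cg) (hh : Summable h) :
    Summable fun u => f u * g u * h u := by
  have hCf : 0 ≤ Cf := (abs_nonneg _).trans (hf 0)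
  have hfg : ∀ u, |f u * g u| ≤ Cf * Cg := fun u => by rw [abs_mul]; exact mul_le_mul (hf u) (hg u) (abs_nonneg _) hCf
  exact summable_mul_of_bdd hfg hh

/-- [folklore] Bounds of the weights and of the increments from the sup bounds. -/
theorem abs_tip_le (hψ : ∀ x, |ψ x| ≤ Bψ) (κ : Fin (d + 1)) (u : Fin (d + 1) → ℤ) : |ψ (u + unitVec κ)| ≤ Bψ := hψ _

/-- [folklore] `|½(ψ u + ψ(u+e))| ≤ Bψ`. -/
theorem abs_mid_le (hψ : ∀ x, |ψ x| ≤ Bψ) (κ : Fin (d + 1)) (u : Fin (d + 1) → ℤ) : |(ψ u + ψ (u + unitVec κ)) / 2| ≤ Bψ := by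
  rw [abs_div, abs_two]
  have h1 := hψ u; have h2 := hψ (u + unitVec κ); have h3 := abs_add_le (ψ u) (ψ (u + unitVec κ))
  linarith

/-- [folklore] `|ψ(u+e) − ψ u| ≤ 2Bψ`. -/
theorem abs_diff_le (hψ : ∀ x, |ψ x| ≤ Bψ) (κ : Fin (d + 1)) (u : Fin (d + 1) → ℤ) : |ψ (u + unitVec κ) - ψ u| ≤ 2 * Bψ := by
  have h1 := hψ u; have h2 := hψ (u + unitVec κ); have h3 := abs_sub (ψ (u + unitVec κ)) (ψ u)
  linarith

/-- NOT IN PRINT; OUR BOOKKEEPING.  **SPLITTING A DRESSED PARTNER IN THE TIP POSITION**: with `M κ` summable for every `κ` and `ψ, B, λ′` bounded,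
`Σ'_u Σ_κ ψ(u+e_κ)·(B κ u + (λ′(u+e_κ) − λ′ u))·M κ u = Σ'_u Σ_κ ψ(u+e_κ)·B κ u·M κ u + Σ_κ Σ'_u M κ u·ψ(u+e_κ)·(λ′(u+e_κ) − λ′ u)`
— the undressed part and the TIP-READ pairing (leaf-03 g52's `StaircasePairingReadings.abs_pairingTip_le_of_geometric`, the owner's choice (b) l.31846). -/
theorem split_tip (hM : ∀ κ, Summable (M κ)) (hψ : ∀ x, |ψ x| ≤ Bψ) (hB : ∀ κ u, |B κ u| ≤ BB) (hg : ∀ x, |lam x| ≤ Bg) :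
    ∑' u, ∑ κ, ψ (u + unitVec κ) * (B κ u + (lam (u + unitVec κ) - lam u)) * M κ u
      = ∑' u, ∑ κ, ψ (u + unitVec κ) * B κ u * M κ u
        + ∑ κ, ∑' u, M κ u * ψ (u + unitVec κ) * (lam (u + unitVec κ) - lam u) := by
  have s1 : ∀ κ, Summable fun u => ψ (u + unitVec κ) * B κ u * M κ u :=
    fun κ => summable_bdd_bdd_mul (fun u => abs_tip_le hψ κ u) (fun u => hB κ u) (hM κ)
  have s2 : ∀ κ, Summable fun u => M κ u * ψ (u + unitVec κ) * (lam (u + unitVec κ) - lam u) := by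
    intro κ
    have h := summable_bdd_bdd_mul (fun u => abs_tip_le hψ κ u) (fun u => abs_diff_le hg κ u) (hM κ)
    exact h.congr fun u => by ring
  have hpt : ∀ u, (∑ κ, ψ (u + unitVec κ) * (B κ u + (lam (u + unitVec κ) - lam u)) * M κ u)
      = (∑ κ, ψ (u + unitVec κ) * B κ u * M κ u) + ∑ κ, M κ u * ψ (u + unitVec κ) * (lam (u + unitVec κ) - lam u) := by
    intro u
    rw [← Finset.sum_add_distrib]
    exact Finset.sum_congr rfl fun κ _ => by ring
  rw [tsum_congr hpt, (summable_sum fun κ _ => s1 κ).tsum_add (summable_sum fun κ _ => s2 κ),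
    Summable.tsum_finsetSum (fun κ _ => s2 κ)]

/-- NOT IN PRINT; OUR BOOKKEEPING.  The same with the ΔΔ cross term made explicit (`ψ_tip = ψ_mid + ½Δψ`; the nine-piece variant (a) of
`CT3C-ANALYSIS-PLAN.md` §3, kept as a socket):
`Σ'_u Σ_κ ψ(u+e_κ)·(B κ u + Δλ′)·M κ u = Σ' Σ ψ_tip·B·M + Σ_κ Σ'_u M κ u·½(ψ u + ψ(u+e_κ))·Δ_κλ′(u) + ½·Σ_κ Σ'_u M κ u·Δ_κψ(u)·Δ_κλ′(u)`. -/
theorem split_tip_mid (hM : ∀ κ, Summable (M κ)) (hψ : ∀ x, |ψ x| ≤ Bψ) (hB : ∀ κ u, |B κ u| ≤ BB) (hg : ∀ x, |lam x| ≤ Bg) :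
    ∑' u, ∑ κ, ψ (u + unitVec κ) * (B κ u + (lam (u + unitVec κ) - lam u)) * M κ u
      = ∑' u, ∑ κ, ψ (u + unitVec κ) * B κ u * M κ u
        + ∑ κ, ∑' u, M κ u * ((ψ u + ψ (u + unitVec κ)) / 2) * (lam (u + unitVec κ) - lam u)
        + (1 / 2 : ℝ) * ∑ κ, ∑' u, M κ u * (ψ (u + unitVec κ) - ψ u) * (lam (u + unitVec κ) - lam u) := by
  -- summability of the three pieces, direction by direction
  have s1 : ∀ κ, Summable fun u => ψ (u + unitVec κ) * B κ u * M κ u :=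
    fun κ => summable_bdd_bdd_mul (fun u => abs_tip_le hψ κ u) (fun u => hB κ u) (hM κ)
  have s2 : ∀ κ, Summable fun u => M κ u * ((ψ u + ψ (u + unitVec κ)) / 2) * (lam (u + unitVec κ) - lam u) := by
    intro κ
    have h := summable_bdd_bdd_mul (fun u => abs_mid_le hψ κ u) (fun u => abs_diff_le hg κ u) (hM κ)
    exact h.congr fun u => by ring
  have s3 : ∀ κ, Summable fun u => M κ u * (ψ (u + unitVec κ) - ψ u) * (lam (u + unitVec κ) - lam u) := by
    intro κ
    have h := summable_bdd_bdd_mul (fun u => abs_diff_le hψ κ u) (fun u => abs_diff_le hg κ u) (hM κ)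
    exact h.congr fun u => by ring
  -- pointwise split
  have hpt : ∀ u, (∑ κ, ψ (u + unitVec κ) * (B κ u + (lam (u + unitVec κ) - lam u)) * M κ u)
      = (∑ κ, ψ (u + unitVec κ) * B κ u * M κ u)
        + ((∑ κ, M κ u * ((ψ u + ψ (u + unitVec κ)) / 2) * (lam (u + unitVec κ) - lam u))
          + (1 / 2 : ℝ) * ∑ κ, M κ u * (ψ (u + unitVec κ) - ψ u) * (lam (u + unitVec κ) - lam u)) := by
    intro u
    rw [Finset.mul_sum, ← Finset.sum_add_distrib, ← Finset.sum_add_distrib]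
    exact Finset.sum_congr rfl fun κ _ => by ring
  have hs23 : Summable fun u => (∑ κ, M κ u * ((ψ u + ψ (u + unitVec κ)) / 2) * (lam (u + unitVec κ) - lam u))
      + (1 / 2 : ℝ) * ∑ κ, M κ u * (ψ (u + unitVec κ) - ψ u) * (lam (u + unitVec κ) - lam u) :=
    (summable_sum fun κ _ => s2 κ).add ((summable_sum fun κ _ => s3 κ).mul_left _)
  rw [tsum_congr hpt, (summable_sum fun κ _ => s1 κ).tsum_add hs23,
    (summable_sum fun κ _ => s2 κ).tsum_add ((summable_sum fun κ _ => s3 κ).mul_left _), tsum_mul_left,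
    Summable.tsum_finsetSum (fun κ _ => s2 κ), Summable.tsum_finsetSum (fun κ _ => s3 κ), add_assoc]

/-- NOT IN PRINT; OUR BOOKKEEPING.  **SPLITTING A DRESSED PARTNER IN THE MIDPOINT POSITION**: with `M b` summable for every `b` and `ψ, B, λ′` bounded,
`Σ'_z Σ_b ½(ψ z + ψ(z+e_b))·(B b z + (λ′(z+e_b) − λ′ z))·M b z = Σ'_z Σ_b ½(ψ z + ψ(z+e_b))·B b z·M b z + Σ_b Σ'_z M b z·½(ψ z + ψ(z+e_b))·(λ′(z+e_b) − λ′ z)`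
— the undressed part and EXACTLY the owner's midpoint pairing. -/
theorem split_mid (hM : ∀ κ, Summable (M κ)) (hψ : ∀ x, |ψ x| ≤ Bψ) (hB : ∀ κ u, |B κ u| ≤ BB) (hg : ∀ x, |lam x| ≤ Bg) :
    ∑' z, ∑ b, (ψ z + ψ (z + unitVec b)) / 2 * (B b z + (lam (z + unitVec b) - lam z)) * M b z
      = ∑' z, ∑ b, (ψ z + ψ (z + unitVec b)) / 2 * B b z * M b z
        + ∑ b, ∑' z, M b z * ((ψ z + ψ (z + unitVec b)) / 2) * (lam (z + unitVec b) - lam z) := by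
  have s1 : ∀ b, Summable fun z => (ψ z + ψ (z + unitVec b)) / 2 * B b z * M b z :=
    fun b => summable_bdd_bdd_mul (fun z => abs_mid_le hψ b z) (fun z => hB b z) (hM b)
  have s2 : ∀ b, Summable fun z => M b z * ((ψ z + ψ (z + unitVec b)) / 2) * (lam (z + unitVec b) - lam z) := by
    intro b
    have h := summable_bdd_bdd_mul (fun z => abs_mid_le hψ b z) (fun z => abs_diff_le hg b z) (hM b)
    exact h.congr fun z => by ring
  have hpt : ∀ z, (∑ b, (ψ z + ψ (z + unitVec b)) / 2 * (B b z + (lam (z + unitVec b) - lam z)) * M b z)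
      = (∑ b, (ψ z + ψ (z + unitVec b)) / 2 * B b z * M b z)
        + ∑ b, M b z * ((ψ z + ψ (z + unitVec b)) / 2) * (lam (z + unitVec b) - lam z) := by
    intro z
    rw [← Finset.sum_add_distrib]
    exact Finset.sum_congr rfl fun b _ => by ring
  rw [tsum_congr hpt, (summable_sum fun b _ => s1 b).tsum_add (summable_sum fun b _ => s2 b),
    Summable.tsum_finsetSum (fun b _ => s2 b)]

/-- NOT IN PRINT; OUR BOOKKEEPING.  The same with a SITE weight (the index cell's nesting):
`Σ'_x Σ_a ψ x·(B a x + (λ′(x+e_a) − λ′ x))·M a x = Σ' Σ ψ x·B a x·M a x + Σ_a Σ'_x M a x·ψ x·(λ′(x+e_a) − λ′ x)`. -/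
theorem split_site (hM : ∀ κ, Summable (M κ)) (hψ : ∀ x, |ψ x| ≤ Bψ) (hB : ∀ κ u, |B κ u| ≤ BB) (hg : ∀ x, |lam x| ≤ Bg) :
    ∑' x, ∑ a, ψ x * (B a x + (lam (x + unitVec a) - lam x)) * M a x
      = ∑' x, ∑ a, ψ x * B a x * M a x + ∑ a, ∑' x, M a x * ψ x * (lam (x + unitVec a) - lam x) := by
  have s1 : ∀ a, Summable fun x => ψ x * B a x * M a x :=
    fun a => summable_bdd_bdd_mul (fun x => hψ x) (fun x => hB a x) (hM a)
  have s2 : ∀ a, Summable fun x => M a x * ψ x * (lam (x + unitVec a) - lam x) := by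
    intro a
    have h := summable_bdd_bdd_mul (fun x => hψ x) (fun x => abs_diff_le hg a x) (hM a)
    exact h.congr fun x => by ring
  have hpt : ∀ x, (∑ a, ψ x * (B a x + (lam (x + unitVec a) - lam x)) * M a x)
      = (∑ a, ψ x * B a x * M a x) + ∑ a, M a x * ψ x * (lam (x + unitVec a) - lam x) := by
    intro x
    rw [← Finset.sum_add_distrib]
    exact Finset.sum_congr rfl fun a _ => by ring
  rw [tsum_congr hpt, (summable_sum fun a _ => s1 a).tsum_add (summable_sum fun a _ => s2 a),
    Summable.tsum_finsetSum (fun a _ => s2 a)]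

end Summit.QuantumFields.BalabanUV.Beta.GAN24.ContactCellSplit

end
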